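import Summits.KontsevichZagierPeriods.KontsevichZagierPeriods.Theorems.GammaHodgeSector.Negative.HodgeTest
import Summits.KontsevichZagierPeriods.KontsevichZagierPeriods.Theorems.GammaHodgeSector.Negative.Algebraicity
import Summits.KontsevichZagierPeriods.KontsevichZagierPeriods.Theorems.GammaHodgeSector.Negative.Calibration
import Literature.NumberTheory.Transcendental.KontsevichZagierGammaProofs

/-!
# `GammaHodgeSector` (stmt-KontsevichZagierPeriods-3742) — negative side V: a refuted
strengthening (the unit quantifier of the Hodge test is essential)

Landed copy of §6 of `Cruxes/GammaHodgeSector/Disproof.lean`: the existential form of the sector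
with the Hodge-type test required ONLY at `u = 1` is FALSE (`not_gammaHodgeSectorExistsAtOne`):
`x = y = ¼`, `N' = 0`, `k = 0` passes the `u = 1` test, and `[(0,1), t^{−3/4}(1−t)^{−3/4}] ~ [pt, c]`
would make `B(¼,¼) = Γ(¼)²/√π` algebraic (`c` is algebraic by the pinning, `Algebraicity`),
against Chudnovsky's algebraic independence of `π` and `Γ(¼)` (proved in the tree,
`algebraicIndependent_real_pi_gamma_one_quarter`). With the FULL test the same data are not in
the sector (`quarter_not_hodgeCondition`).
-/

noncomputable section

open MeasureTheory Set
open scoped BigOperators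

namespace Summit.KontsevichZagierPeriods.GammaHodgeSectorNegative

open Literature.NumberTheory.Transcendental
open Literature.NumberTheory.Transcendental.KZ
open Literature.ModelTheory.ExponentialFields (IsSemialgebraic isSemialgebraic_univ)
open Summit.KontsevichZagierPeriods.KontsevichZagierPeriods.Theses.TerasomaMultiplication (GammaHodgeSector)

/-! ## §6 A refuted strengthening: the unit quantifier `∀ u` of the Hodge test is essential

The natural EXISTENTIAL form of the sector ("for Hodge-type data the cube representation is
equivalent to SOME `[ball × cube, c·k!·Π]`") is the crux plus Deligne/Koblitz–Ogus (the tree's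
`deligne_gammaMonomial_algebraic_holds` supplies the algebraic `c` making the values agree), hence
summit-implied and not attackable. But the same form with the test required ONLY AT `u = 1` is
FALSE (`not_gammaHodgeSectorExistsAtOne`): `x = y = ¼` passes the `u = 1` test with `k = 0`, and an
equivalence `[(0,1), t^{−3/4}(1−t)^{−3/4}] ~ [pt, c]` would make `B(¼,¼) = Γ(¼)²/√π` algebraic,
against Chudnovsky (`π`, `Γ(¼)` algebraically independent — PROVED in the tree,
`algebraicIndependent_real_pi_gamma_one_quarter`). So the decidable test of the crux cannot be
cheapened to its `u = 1` instance. -/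

section Strengthening

/-- The Hodge-type test at the single unit `u = 1`. [folklore] -/
def HodgeConditionAtOne (N N' k : ℕ) (x y : Fin N → ℚ) (x' y' : Fin N' → ℚ) : Prop :=
  hodgeSum x y 1 - hodgeSum x' y' 1 = (k : ℚ)

/-- The full test implies the test at `u = 1`. [folklore] -/
theorem HodgeCondition.atOne {N N' k : ℕ} {x y : Fin N → ℚ} {x' y' : Fin N' → ℚ}
    (h : HodgeCondition N N' k x y x' y') : HodgeConditionAtOne N N' k x y x' y' :=
  h 1 one_pos (fun _ => ⟨Nat.coprime_one_left _, Nat.coprime_one_left _⟩)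
    (fun _ => ⟨Nat.coprime_one_left _, Nat.coprime_one_left _⟩)

/-- STRENGTHENING (refuted below): the existential form of the sector with the Hodge-type test
required only at `u = 1` — "for admissible data passing the `u = 1` test, the cube representation
is KZ-equivalent to SOME representation `[ball × cube, c · k! · Π]`". -/
def GammaHodgeSectorExistsAtOne : Prop :=
  ∀ (N N' k : ℕ) (x y : Fin N → ℚ) (x' y' : Fin N' → ℚ),
    Admissible x y → Admissible x' y' → HodgeConditionAtOne N N' k x y x' y' →
    ∀ r : IntegralRep N, IsCubeBetaRep x y r →
      ∃ (c : ℝ) (r' : IntegralRep (2 * k + N')), IsBallCubeRep k x' y' c r' ∧ Equivalent r r'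

/-- The integrand `t^{−3/4}(1−t)^{−3/4}` of `B(¼,¼)` on `ℝ¹`. [folklore] -/
def quarterFun (t : Fin 1 → ℝ) : ℝ := (t 0) ^ (-(3 / 4 : ℝ)) * (1 - t 0) ^ (-(3 / 4 : ℝ))

/-- On `(0,1)`: `t^{−3/4}(1−t)^{−3/4} = 1/(√p · √√p)`, `p = t(1−t)`. [folklore] -/
theorem quarterFun_eq_inv_sqrt {t : Fin 1 → ℝ} (ht : t ∈ unitIntervalDomain) :
    quarterFun t =
      (Real.sqrt (t 0 * (1 - t 0)) * Real.sqrt (Real.sqrt (t 0 * (1 - t 0))))⁻¹ := by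
  rw [mem_unitIntervalDomain] at ht
  have h0 : 0 ≤ t 0 := ht.1.le
  have h1 : 0 ≤ 1 - t 0 := by linarith [ht.2]
  have hp : 0 < t 0 * (1 - t 0) := mul_pos ht.1 (by linarith [ht.2])
  rw [quarterFun, ← Real.mul_rpow h0 h1, Real.rpow_neg hp.le,
    show (3 / 4 : ℝ) = 1 / 2 + 1 / 4 by norm_num, Real.rpow_add hp, Real.sqrt_eq_rpow,
    Real.sqrt_eq_rpow, ← Real.rpow_mul hp.le]
  norm_num

/-- The `B(¼,¼)` integrand is `ℚ`-semialgebraic on `(0,1)`. [folklore] -/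
theorem isSemialgebraicFunOn_quarterFun : IsSemialgebraicFunOn ℚ unitIntervalDomain quarterFun := by
  have hW := isSemialgebraic_unitIntervalDomain
  have hx : IsSemialgebraicFunOn ℚ unitIntervalDomain (fun t => t 0) :=
    (isSemialgebraicFunOn_aeval hW (MvPolynomial.X 0)).congr fun t _ => by simp
  have h1x : IsSemialgebraicFunOn ℚ unitIntervalDomain (fun t => 1 - t 0) :=
    (isSemialgebraicFunOn_aeval hW (1 - MvPolynomial.X 0)).congr fun t _ => by simp
  have hp := hx.fun_mul h1x
  exact ((hp.fun_sqrt.fun_mul hp.fun_sqrt.fun_sqrt).fun_inv).congr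
    fun t ht => (quarterFun_eq_inv_sqrt ht).symm

/-- The `B(¼,¼)` integrand is the beta integrand `(¼,¼)` transported along `ℝ¹ ≃ ℝ`. [folklore] -/
theorem quarterFun_eq_comp :
    quarterFun = (fun x : ℝ => x ^ ((1 / 4 : ℝ) - 1) * (1 - x) ^ ((1 / 4 : ℝ) - 1)) ∘
      (MeasurableEquiv.funUnique (Fin 1) ℝ) := by
  funext t
  simp only [quarterFun, Function.comp_apply]
  rw [show ((1 / 4 : ℝ) - 1) = -(3 / 4) by norm_num]
  simp [MeasurableEquiv.funUnique]

/-- Integrability of the `B(¼,¼)` integrand on `(0,1)`. [folklore] -/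
theorem integrableOn_quarterFun : IntegrableOn quarterFun unitIntervalDomain := by
  have h := (integrableOn_betaIntegrand_and_integral_eq (α := 1 / 4) (β := 1 / 4)
    (by norm_num) (by norm_num)).1
  rw [unitIntervalDomain_eq_preimage, quarterFun_eq_comp]
  exact ((volume_preserving_funUnique (Fin 1) ℝ).integrableOn_comp_preimage
    (MeasurableEquiv.measurableEmbedding _)).mpr h

/-- `B(¼,¼) = Γ(¼)²/√π`. [folklore] -/
theorem beta_quarter_quarter :
    ProbabilityTheory.beta (1 / 4) (1 / 4) = Real.Gamma (1 / 4) ^ 2 / Real.sqrt Real.pi := by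
  rw [ProbabilityTheory.beta, show (1 / 4 : ℝ) + 1 / 4 = 1 / 2 by norm_num, Real.Gamma_one_half_eq,
    sq]

/-- `∫_{(0,1)} t^{−3/4}(1−t)^{−3/4} dt = Γ(¼)²/√π`. [folklore] -/
theorem setIntegral_quarterFun :
    ∫ t in unitIntervalDomain, quarterFun t = Real.Gamma (1 / 4) ^ 2 / Real.sqrt Real.pi := by
  have h := (integrableOn_betaIntegrand_and_integral_eq (α := 1 / 4) (β := 1 / 4)
    (by norm_num) (by norm_num)).2
  rw [beta_quarter_quarter] at h
  rw [unitIntervalDomain_eq_preimage, quarterFun_eq_comp, ← h]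
  exact (volume_preserving_funUnique (Fin 1) ℝ).setIntegral_preimage_emb
    (MeasurableEquiv.measurableEmbedding _)
    (fun x : ℝ => x ^ ((1 / 4 : ℝ) - 1) * (1 - x) ^ ((1 / 4 : ℝ) - 1)) (Ioo 0 1)

/-- The representation `[(0,1), t^{−3/4}(1−t)^{−3/4}]` of `B(¼,¼)`. -/
def quarterRep : IntegralRep 1 where
  domain := unitIntervalDomain
  integrand := quarterFun
  isSemialgebraic_domain := isSemialgebraic_unitIntervalDomain
  isSemialgebraicFunOn_integrand := isSemialgebraicFunOn_quarterFun
  integrableOn := integrableOn_quarterFun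

/-- `value quarterRep = Γ(¼)²/√π`. [folklore] -/
theorem quarterRep_value : quarterRep.value = Real.Gamma (1 / 4) ^ 2 / Real.sqrt Real.pi :=
  setIntegral_quarterFun

/-- `quarterRep` is the cube representation at `N = 1`, `x = y = ¼`. [folklore] -/
theorem isCubeBetaRep_quarterRep :
    IsCubeBetaRep (fun _ : Fin 1 => (1 / 4 : ℚ)) (fun _ => 1 / 4) quarterRep := by
  refine ⟨rfl, fun t _ => ?_⟩
  simp only [quarterRep, quarterFun, Fin.prod_univ_one]
  push_cast
  norm_num

/-- `x = y = ¼` passes the test at `u = 1` with `k = 0`: `{¼} + {¼} − {½} = 0`. [folklore] -/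
theorem hodgeConditionAtOne_quarter :
    HodgeConditionAtOne 1 0 0 (fun _ : Fin 1 => (1 / 4 : ℚ)) (fun _ => 1 / 4) Fin.elim0 Fin.elim0 := by
  have h4 : Int.fract (1 / 4 : ℚ) = 1 / 4 := Int.fract_eq_self.mpr ⟨by norm_num, by norm_num⟩
  have h2 : Int.fract (1 / 4 + 1 / 4 : ℚ) = 1 / 2 := by
    rw [show (1 / 4 + 1 / 4 : ℚ) = 1 / 2 by norm_num]
    exact Int.fract_eq_self.mpr ⟨by norm_num, by norm_num⟩
  simp only [HodgeConditionAtOne, hodgeSum, Nat.cast_one, one_mul, Finset.univ_unique,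
    Fin.default_eq_zero, Finset.sum_singleton, h4, h2, Finset.univ_eq_empty, Finset.sum_empty]
  norm_num

/-- `Γ(¼)²/√π` is transcendental — indeed `π ∉ ℚ(Γ(¼))^{alg}`: from Chudnovsky's algebraic
independence of `π` and `Γ(¼)` (tree: `algebraicIndependent_real_pi_gamma_one_quarter`). Stated
in the form used below: no algebraic `c` has `Γ(¼)²/√π = c`. [cite: Chudnovsky1984, Ch. 7 §2 Corollary 2.3] -/
theorem not_isAlgebraic_gamma_quarter_sq_div_sqrt_pi {c : ℝ} (hc : IsAlgebraic ℚ c)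
    (h : Real.Gamma (1 / 4) ^ 2 / Real.sqrt Real.pi = c) : False := by
  set γ : ℝ := Real.Gamma (1 / 4) with hγ
  have hγpos : 0 < γ := Real.Gamma_pos_of_pos (by norm_num)
  have hsqrt : 0 < Real.sqrt Real.pi := Real.sqrt_pos.mpr Real.pi_pos
  have hcpos : 0 < c := by rw [← h]; positivity
  -- `π = (c²)⁻¹ · γ⁴`
  have hpi : Real.pi = (c ^ 2)⁻¹ * γ ^ 4 := by
    have h2 : c ^ 2 = γ ^ 4 / Real.pi := by
      rw [← h, div_pow, Real.sq_sqrt Real.pi_pos.le]; ring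
    rw [h2]
    field_simp
  -- transcendence of `π` over `ℚ(γ)`
  have hind := algebraicIndependent_real_pi_gamma_one_quarter
  have hT : Transcendental (Algebra.adjoin ℚ ((![Real.pi, γ]) '' ({1} : Set (Fin 2)))) (![Real.pi, γ] 0) :=
    hind.transcendental_adjoin (s := {1}) (i := 0) (by simp)
  have himg : (![Real.pi, γ]) '' ({1} : Set (Fin 2)) = {γ} := by
    rw [image_singleton]; rfl
  rw [himg] at hT
  have hT' : Transcendental (IntermediateField.adjoin ℚ ({γ} : Set ℝ)) Real.pi :=
    IntermediateField.transcendental_adjoin_iff.mpr hT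
  -- but `π = (c²)⁻¹ γ⁴` is algebraic over `ℚ(γ)`
  set K := IntermediateField.adjoin ℚ ({γ} : Set ℝ) with hK
  have hγK : γ ∈ K := IntermediateField.mem_adjoin_simple_self ℚ γ
  have h1 : IsAlgebraic K γ := by
    simpa using isAlgebraic_algebraMap (R := K) (A := ℝ) ⟨γ, hγK⟩
  have h2 : IsAlgebraic K ((c ^ 2)⁻¹) := ((hc.pow 2).inv).tower_top K
  have h3 : IsAlgebraic K Real.pi := by
    rw [hpi]
    exact h2.mul (h1.pow 4)
  exact hT' h3

/-- **The strengthening is FALSE: the unit quantifier of the Hodge test is essential.** Witness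
`N = 1, N' = 0, k = 0`, `x = y = ¼` (admissible; passes the `u = 1` test, fails it at `u = 3`),
`r = quarterRep`: an equivalence `r ~ r'` with `r'` pinned as `[pt, c · 0! · 1]` forces (i) `c`
algebraic (§4, pinning) and (ii) `B(¼,¼) = Γ(¼)²/√π = c` (soundness, `vol ℝ⁰ = 1`), contradicting
Chudnovsky. [cite: Chudnovsky1984, Ch. 7 §2 Corollary 2.3] -/
theorem not_gammaHodgeSectorExistsAtOne : ¬ GammaHodgeSectorExistsAtOne := by
  intro h
  have hadm : Admissible (fun _ : Fin 1 => (1 / 4 : ℚ)) (fun _ => 1 / 4) := by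
    have h4 : Int.fract (1 / 4 : ℚ) = 1 / 4 := Int.fract_eq_self.mpr ⟨by norm_num, by norm_num⟩
    exact fun _ => ⟨by norm_num, by norm_num, by rw [h4]; norm_num, by rw [h4]; norm_num⟩
  obtain ⟨c, r', hr', hE⟩ := h 1 0 0 _ _ Fin.elim0 Fin.elim0 hadm admissible_elim0
    hodgeConditionAtOne_quarter quarterRep isCubeBetaRep_quarterRep
  have halg : IsAlgebraic ℚ c := isAlgebraic_of_isBallCubeRep hr'
  change IntegralRep 0 at r'
  have hdr' : r'.domain = univ := by rw [hr'.1]; ext; simp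
  have hval' : r'.value = c := by
    rw [value_dim_zero r' hdr', hr'.2 (by rw [hdr']; exact mem_univ _)]
    simp
  have hv : quarterRep.value = r'.value := Equivalent.value_eq_holds hE
  rw [quarterRep_value, hval'] at hv
  exact not_isAlgebraic_gamma_quarter_sq_div_sqrt_pi halg hv

/-- For contrast, the crux itself is untouched by the witness: with the FULL test the data
`x = y = ¼`, `N' = 0` are not in the sector at all (`reflection_sector_of_N_one` forces `k = 1`
and `x + y ∈ ℤ`). [folklore] -/
theorem quarter_not_hodgeCondition (k : ℕ) :
    ¬ HodgeCondition 1 0 k (fun _ : Fin 1 => (1 / 4 : ℚ)) (fun _ => 1 / 4) Fin.elim0 Fin.elim0 := by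
  intro hH
  have hadm : Admissible (fun _ : Fin 1 => (1 / 4 : ℚ)) (fun _ => 1 / 4) := by
    have h4 : Int.fract (1 / 4 : ℚ) = 1 / 4 := Int.fract_eq_self.mpr ⟨by norm_num, by norm_num⟩
    exact fun _ => ⟨by norm_num, by norm_num, by rw [h4]; norm_num, by rw [h4]; norm_num⟩
  obtain ⟨-, hfr⟩ := reflection_sector_of_N_one hadm hH
  have : Int.fract ((1 / 4 : ℚ) + 1 / 4) = 1 / 2 := by
    rw [show ((1 / 4 : ℚ) + 1 / 4) = 1 / 2 by norm_num]
    exact Int.fract_eq_self.mpr ⟨by norm_num, by norm_num⟩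
  rw [this] at hfr
  norm_num at hfr

end Strengthening


end Summit.KontsevichZagierPeriods.GammaHodgeSectorNegative
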